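import Mathlib
import Literature.Analysis.FluidPDE.VectorCalculus
import Literature.Analysis.FluidPDE.VorticityCalculus
import Literature.Analysis.FluidPDE.VorticityStretching
import Literature.Analysis.FluidPDE.BiotSavartNewtonKernel
import Summits.NavierStokesRegularity.NavierStokesRegularity.Theorems.ThreadingFluxAzimuthalCartanDefs
import Summits.NavierStokesRegularity.NavierStokesRegularity.Theorems.ThreadingFluxAzimuthalCartanLocalCurlCurl
import Summits.NavierStokesRegularity.NavierStokesRegularity.Theorems.ThreadingFluxAzimuthalCartanHalfSpaceCoords
import Summits.NavierStokesRegularity.NavierStokesRegularity.Theorems.ThreadingFluxAzimuthalCartanVertexWitness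
import Summits.NavierStokesRegularity.NavierStokesRegularity.Theorems.TypeIQuarterGateScarEnvelopeTypeIForcedTsaiStokesletSelfAdvection
import Summits.NavierStokesRegularity.NavierStokesRegularity.Theorems.UnthreadedDoorKinematicShadowZonalLawComponents
import Summits.NavierStokesRegularity.NavierStokesRegularity.Theorems.ExtremiserTransienceNearExtremalTransienceExtremiserLiouvilleConstantSpeedLinearMoments
import HarnessLib

/-!
# Crux `PoloidalLiouville` (stmt-NavierStokesRegularity-1222, wall W1), crux idea «azimuthal-cartan-test» (ns-idea-15 g10):
# ŠVERÁK'S CONFORMAL CORRESPONDENCE, CONSTRUCTIVE DIRECTION (K♯ item 1) — Liouville's equation on a cone ⇒ a steady conical NS flow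

Support file (`--supports stmt-NavierStokesRegularity-1222`, helper; cell `ns-wall-extremal`, width hand ns-wall-eng-6 g5, 0 kit).

Šverák (arXiv:math/0604550 = J. Math. Sci. 179 (2011), §3–§4) writes a `(−1)`-homogeneous steady Navier–Stokes flow on a cone as
`u = ∇Φ + f x/|x|²` with `Φ` homogeneous of degree `0` and `f = ⟪x, u⟫`, and shows (for flows smooth on all of `S²`) that
`2 + f = 2e^{Φ}` and that `φ = Φ|_{S²}` solves LIOUVILLE'S EQUATION `−Δ_{S²}φ + 2 = 2e^{φ}`; the tree proves that direction
(`Literature.Analysis.FluidPDE.Sverak2011.exists_conformal_potential`, the series `SverakLandau*`).  This file proves the CONVERSE,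
which is what produces examples: in the `ℝ³` rendering (`Δ_{S²}φ = |x|² ΔΦ` for `0`-homogeneous `Φ`, and `ΔΦ = tr ∇²Φ`),

* data `LiouvilleCone U Φ g H`: `U` open, `0 ∉ U`, `Φ` real-analytic on `U` with gradient `g` and Hessian `H` there, EULER
  `⟪x, ∇Φ(x)⟫ = 0` (degree `0`) and LIOUVILLE `|x|² tr H(x) + 2e^{Φ(x)} − 2 = 0` on `U`;
* the CONICAL FLOW `conicalField Φ = ∇Φ + h·x`, `h = radialCoeff Φ = (2e^{Φ} − 2)/|x|²`, and its pressure
  `conicalPressure Φ = h − ½|∇Φ|²`;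
* THIS FILE (kinematics): symmetry of `H` (`hessian_symm`, from `second_derivative_symmetric_of_eventually` — not assumed), Euler
  differentiated (`hessian_apply_self : H x = −g`), `tr H = −h` (`trace_hessian`), the explicit Jacobian `Du = dField = H + h·Id + x ⊗ Dh`
  (`hasFDerivAt_conicalField`), ★ `div u = 0` (`divergence_conicalField`), ★ `curl u = (2e^{Φ}/|x|²)(∇Φ × x)` (`curl_conicalField`),
  ★ unthreaded about the vertex (`inner_curl_conicalField`), ★ homogeneous of degree `−1` (`fderiv_conicalField_apply_self`);
* the sequel `ThreadingFluxAzimuthalCartanConicalSteadyNS.lean` (dynamics): analyticity, `Δu` through the LOCAL `Δ = −curl curl`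
  of ns-wall-eng-7, `∇p`, the momentum identity, and the bundle `LiouvilleCone.correspondence` (`IsSteadyNSOn`, `IsUnthreadedOn`,
  `IsMinusOneHomogeneousOn`, analyticity — every clause of K♯ `PoloidalConicalFlows` except `curl ≢ 0` and NO AXIS, which depend on the
  particular `Φ`; the witness files `…ConicalWitness*` supply a rational non-axisymmetric `e^{Φ}`).

The Landau solutions are the case `e^{Φ} = (c² − 1)|x|²/(c|x| − ⟪a, x⟫)²` (Möbius data); non-Möbius data give non-axisymmetric conical
flows (K♯).

HONEST FRAME: steady, explicit, local vector calculus strictly below W1; closes no crux; `PoloidalLiouville` (1222), `SteadyShellRigidity`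
off the homogeneous stratum and NS regularity are OPEN / NOT proved.

## References
* V. Šverák, On Landau's solutions of the Navier–Stokes equations, J. Math. Sci. 179 (2011) 208–228, arXiv:math/0604550, §3–§4. [Sverak2011]
* L. Li, Y. Y. Li, X. Yan, Homogeneous solutions of stationary Navier–Stokes equations with isolated singularities on the unit sphere,
  arXiv:1609.08197 (the conformal/Liouville description of the `(−1)`-homogeneous solutions with `u_{tan} = ∇φ`).
-/

-- the summit and its single sub-problem share the name (CONVENTIONS §1)
set_option linter.dupNamespace false

noncomputable section

namespace Summit.NavierStokesRegularity.NavierStokesRegularity.Theorems.PoloidalLiouville.AzimuthalCartan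

open Set Function Filter Topology Metric
open scoped ContDiff RealInnerProductSpace
open Literature.Analysis.FluidPDE
open Summit.NavierStokesRegularity.NavierStokesRegularity.Theorems.PoloidalLiouville.CentreJet (E3 IsSteadyNSOn)
open Summit.NavierStokesRegularity.NavierStokesRegularity.Cruxes.ScarEnvelopeTypeI.ForcedTsai
  (gradient_eq_of_hasFDerivAt_innerSL fderiv_eq_innerSL_gradient')
open Summit.NavierStokesRegularity.NavierStokesRegularity.Theorems.PoloidalLiouville.AzimuthalCartan.HalfSpace (hasFDerivAt_div)
open Summit.NavierStokesRegularity.NavierStokesRegularity.Theorems.PoloidalLiouville.HorizonTower (inner_cross_self_right)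
open Summit.NavierStokesRegularity.NavierStokesRegularity.Theorems.PoloidalLiouville.KinematicShadow (cross_smul_sub_smul_left)
open Summit.NavierStokesRegularity.NavierStokesRegularity.Theorems.ExtremiserLiouville (curlCLM_id)

/-! ### The objects -/

/-- The radial coefficient `h = (2e^{Φ} − 2)/|x|²` (Šverák's `f/|x|²` with `2 + f = 2e^{Φ}`); junk value at the vertex `x = 0` (`/0 = 0`),
never used (`LiouvilleCone` data live on `U ∌ 0`). -/
def radialCoeff (Φ : E3 → ℝ) (x : E3) : ℝ := (2 * Real.exp (Φ x) - 2) / ‖x‖ ^ 2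

/-- The CONICAL FLOW of the potential `Φ`: `u = ∇Φ + h·x`, `h = (2e^{Φ} − 2)/|x|²`. -/
def conicalField (Φ : E3 → ℝ) (x : E3) : E3 := gradient Φ x + radialCoeff Φ x • x

/-- Its pressure `p = h − ½|∇Φ|²`. -/
def conicalPressure (Φ : E3 → ℝ) (x : E3) : ℝ := radialCoeff Φ x - ‖gradient Φ x‖ ^ 2 / 2

/-- The differential of the radial coefficient: `Dh = (2e^{Φ}/|x|²)⟪∇Φ, ·⟫ − (2h/|x|²)⟪x, ·⟫`. -/
def dRadial (Φ : E3 → ℝ) (g : E3 → E3) (x : E3) : E3 →L[ℝ] ℝ :=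
  (2 * Real.exp (Φ x) / ‖x‖ ^ 2) • innerSL ℝ (g x) - (2 * radialCoeff Φ x / ‖x‖ ^ 2) • innerSL ℝ x

/-- The Jacobian of the conical flow: `Du = H + h·Id + x ⊗ Dh`. -/
def dField (Φ : E3 → ℝ) (g : E3 → E3) (H : E3 → E3 →L[ℝ] E3) (x : E3) : E3 →L[ℝ] E3 :=
  H x + radialCoeff Φ x • ContinuousLinearMap.id ℝ E3 + (dRadial Φ g x).smulRight x

/-- **Liouville data on a cone.**  `U` is open and misses the vertex `0`; `Φ` is real-analytic on `U` with `DΦ = ⟪g, ·⟫` and `Dg = H`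
there; `Φ` is homogeneous of degree `0` (Euler: `⟪x, g x⟫ = 0`) and solves Liouville's equation in `ℝ³` form,
`|x|² tr H(x) + 2e^{Φ(x)} − 2 = 0` (`= |x|²ΔΦ + 2e^Φ − 2`, i.e. `−Δ_{S²}φ + 2 = 2e^{φ}` for `φ = Φ|_{S²}`). [folklore] -/
structure LiouvilleCone (U : Set E3) (Φ : E3 → ℝ) (g : E3 → E3) (H : E3 → E3 →L[ℝ] E3) : Prop where
  isOpen : IsOpen U
  ne_zero : ∀ x ∈ U, x ≠ 0
  analyticOnNhd : AnalyticOnNhd ℝ Φ U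
  hasFDerivAt_potential : ∀ x ∈ U, HasFDerivAt Φ (innerSL ℝ (g x)) x
  hasFDerivAt_gradient : ∀ x ∈ U, HasFDerivAt g (H x) x
  euler : ∀ x ∈ U, ⟪x, g x⟫ = 0
  liouville : ∀ x ∈ U, ‖x‖ ^ 2 * (∑ i, H x (EuclideanSpace.single i 1) i) + 2 * Real.exp (Φ x) - 2 = 0

/-! ### Coordinate tools -/

/-- Components of the Jacobian applied to a vector: `(Du v)ᵢ = (H v)ᵢ + h vᵢ + (Dh v) xᵢ`. -/
theorem dField_apply (Φ : E3 → ℝ) (g : E3 → E3) (H : E3 → E3 →L[ℝ] E3) (x v : E3) (i : Fin 3) :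
    dField Φ g H x v i = H x v i + radialCoeff Φ x * v i + dRadial Φ g x v * x i := by
  simp [dField, mul_comm]

/-- A linear functional summed against the coordinates: `∑ᵢ ℓ(eᵢ) yᵢ = ℓ y`. -/
theorem sum_apply_single_mul (ℓ : E3 →L[ℝ] ℝ) (y : E3) : ∑ i, ℓ (EuclideanSpace.single i 1) * y i = ℓ y := by
  have hy : y = y 0 • EuclideanSpace.single 0 (1 : ℝ) + y 1 • EuclideanSpace.single 1 (1 : ℝ) +
      y 2 • EuclideanSpace.single 2 (1 : ℝ) := by
    ext i; fin_cases i <;> simp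
  conv_rhs => rw [hy]
  simp only [map_add, map_smul, smul_eq_mul, Fin.sum_univ_three]
  ring

/-- `(a w − b y) × y = a (w × y)` for the tree's `cross`. -/
theorem cross_sub_smul_self (a b : ℝ) (w y : E3) : cross (a • w - b • y) y = a • cross w y := by
  ext i
  fin_cases i <;> simp [cross, cross_apply]

/-- BAC−CAB for the tree's `cross`: `u × (v × w) = ⟪u, w⟫ v − ⟪u, v⟫ w`. -/
theorem cross_cross_eq (u v w : E3) : cross u (cross v w) = ⟪u, w⟫ • v - ⟪u, v⟫ • w := by
  ext i
  fin_cases i <;> simp [cross, cross_apply, PiLp.inner_apply, RCLike.inner_apply, Fin.sum_univ_three] <;> ring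

/-- `curl (a × ·) = 2a`: `curlCLM` of the linear map `v ↦ a × v`. -/
theorem curlCLM_precompR_id (a : E3) :
    curlCLM ((crossCLM.precompR E3) a (ContinuousLinearMap.id ℝ E3)) = (2 : ℝ) • a := by
  rw [curlCLM_apply]
  ext i
  fin_cases i <;> simp [cross, cross_apply] <;> ring

/-- `curl (y ↦ L y × b) = L b − (tr L) b` for a linear `L` and a fixed vector `b`. -/
theorem curlCLM_precompL (L : E3 →L[ℝ] E3) (b : E3) :
    curlCLM ((crossCLM.precompL E3) L b) = L b - (∑ i, L (EuclideanSpace.single i 1) i) • b := by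
  rw [curlCLM_apply]
  ext i
  fin_cases i <;> simp [cross, cross_apply, clm_apply_coord L b, Fin.sum_univ_three] <;> ring

/-- `Dh` is the inner product with the vector `c g − (2h/|x|²) x`. -/
theorem dRadial_eq_innerSL (Φ : E3 → ℝ) (g : E3 → E3) (x : E3) :
    dRadial Φ g x = innerSL ℝ ((2 * Real.exp (Φ x) / ‖x‖ ^ 2) • g x - (2 * radialCoeff Φ x / ‖x‖ ^ 2) • x) := by
  ext v
  simp only [dRadial, sub_apply, smul_apply, innerSL_apply_apply, smul_eq_mul, inner_sub_left, inner_smul_left, conj_trivial]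

namespace LiouvilleCone

variable {U : Set E3} {Φ : E3 → ℝ} {g : E3 → E3} {H : E3 → E3 →L[ℝ] E3} (hc : LiouvilleCone U Φ g H) {x : E3}
include hc

/-! ### First-order structure: gradient, symmetry of the Hessian, Euler -/

/-- `∇Φ = g` on `U`. -/
theorem gradient_eq (hx : x ∈ U) : gradient Φ x = g x :=
  gradient_eq_of_hasFDerivAt_innerSL (hc.hasFDerivAt_potential x hx)

/-- `|x| ≠ 0` on `U`. -/
theorem norm_ne_zero (hx : x ∈ U) : ‖x‖ ≠ 0 := norm_ne_zero_iff.mpr (hc.ne_zero x hx)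

/-- `0 < |x|²` on `U`. -/
theorem norm_sq_pos (hx : x ∈ U) : 0 < ‖x‖ ^ 2 := by
  have := hc.norm_ne_zero hx
  positivity

/-- **The Hessian is symmetric**: `⟪H v, w⟫ = ⟪v, H w⟫` (symmetry of second derivatives; `DΦ = ⟪g, ·⟫` near `x`). -/
theorem hessian_symm (hx : x ∈ U) (v w : E3) : ⟪H x v, w⟫ = ⟪v, H x w⟫ := by
  have hev : ∀ᶠ y in 𝓝 x, HasFDerivAt Φ ((fun y => innerSL ℝ (g y)) y) y := by
    filter_upwards [hc.isOpen.mem_nhds hx] with y hy using hc.hasFDerivAt_potential y hy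
  have hx' : HasFDerivAt (fun y => innerSL ℝ (g y)) ((innerSL ℝ : E3 →L[ℝ] E3 →L[ℝ] ℝ).comp (H x)) x :=
    (innerSL ℝ : E3 →L[ℝ] E3 →L[ℝ] ℝ).hasFDerivAt.comp x (hc.hasFDerivAt_gradient x hx)
  have h := second_derivative_symmetric_of_eventually hev hx' v w
  simp only [ContinuousLinearMap.coe_comp, Function.comp_apply, innerSL_apply_apply] at h
  rw [h, real_inner_comm]

/-- Matrix entries of the Hessian are symmetric: `(H eⱼ)ᵢ = (H eᵢ)ⱼ`. -/
theorem hessian_entry_symm (hx : x ∈ U) (i j : Fin 3) :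
    H x (EuclideanSpace.single j 1) i = H x (EuclideanSpace.single i 1) j := by
  have h := hc.hessian_symm hx (EuclideanSpace.single j 1) (EuclideanSpace.single i 1)
  rw [EuclideanSpace.inner_single_right, EuclideanSpace.inner_single_left] at h
  simpa using h

/-- **Euler's relation differentiated**: `⟪v, g x⟫ + ⟪x, H v⟫ = 0` (the derivative of `y ↦ ⟪y, g y⟫ ≡ 0` on the open `U`). -/
theorem euler_fderiv (hx : x ∈ U) (v : E3) : ⟪v, g x⟫ + ⟪x, H x v⟫ = 0 := by
  have hD : HasFDerivAt (fun y : E3 => ⟪y, g y⟫)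
      ((fderivInnerCLM ℝ ((id x : E3), g x)).comp ((ContinuousLinearMap.id ℝ E3).prod (H x))) x :=
    (hasFDerivAt_id x).inner ℝ (hc.hasFDerivAt_gradient x hx)
  have h0 : HasFDerivAt (fun y : E3 => ⟪y, g y⟫) (0 : E3 →L[ℝ] ℝ) x := by
    have hev : (fun y : E3 => ⟪y, g y⟫) =ᶠ[𝓝 x] fun _ => (0 : ℝ) := by
      filter_upwards [hc.isOpen.mem_nhds hx] with y hy using hc.euler y hy
    exact (hasFDerivAt_const (0 : ℝ) x).congr_of_eventuallyEq hev
  have huniq := hD.unique h0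
  have := congrArg (fun L : E3 →L[ℝ] ℝ => L v) huniq
  rw [add_comm]
  simpa [fderivInnerCLM_apply] using this

/-- **`H x = −g`**: the gradient of a degree-`0` function is homogeneous of degree `−1`. -/
theorem hessian_apply_self (hx : x ∈ U) : H x x = -g x := by
  have h : ∀ v : E3, ⟪H x x + g x, v⟫ = 0 := fun v => by
    rw [inner_add_left, hc.hessian_symm hx, real_inner_comm v (g x)]
    linarith [hc.euler_fderiv hx v]
  have := h (H x x + g x)
  rw [inner_self_eq_zero] at this
  exact eq_neg_of_add_eq_zero_left this

/-- The trace of the Hessian: `tr H = −h` (Liouville's equation solved for `ΔΦ`). -/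
theorem trace_hessian (hx : x ∈ U) : ∑ i, H x (EuclideanSpace.single i 1) i = -radialCoeff Φ x := by
  have h := hc.liouville x hx
  have hr := hc.norm_sq_pos hx
  have hT : ∑ i, H x (EuclideanSpace.single i 1) i = (2 - 2 * Real.exp (Φ x)) / ‖x‖ ^ 2 := by
    rw [eq_div_iff hr.ne']
    linarith
  rw [hT, radialCoeff]
  ring

/-- The useful relation between `c = 2e^{Φ}/|x|²` and `h`: `c = h + 2/|x|²`. -/
theorem two_exp_div (hx : x ∈ U) : 2 * Real.exp (Φ x) / ‖x‖ ^ 2 = radialCoeff Φ x + 2 / ‖x‖ ^ 2 := by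
  have hr := hc.norm_sq_pos hx
  rw [radialCoeff]
  field_simp
  ring

/-! ### The Jacobian of the conical flow -/

/-- The derivative of the radial coefficient. -/
theorem hasFDerivAt_radialCoeff (hx : x ∈ U) : HasFDerivAt (radialCoeff Φ) (dRadial Φ g x) x := by
  have hr := hc.norm_sq_pos hx
  have hnum : HasFDerivAt (fun y : E3 => 2 * Real.exp (Φ y) - 2) ((2 * Real.exp (Φ x)) • innerSL ℝ (g x)) x := by
    have h := ((hc.hasFDerivAt_potential x hx).exp.const_mul 2).sub_const 2
    refine h.congr_fderiv ?_
    ext v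
    simp only [smul_apply, innerSL_apply_apply, smul_eq_mul]
    ring
  have hden : HasFDerivAt (fun y : E3 => ‖y‖ ^ 2) (2 • innerSL ℝ x) x := (hasStrictFDerivAt_norm_sq x).hasFDerivAt
  have h := hasFDerivAt_div hnum hden hr.ne'
  refine h.congr_fderiv ?_
  ext v
  simp only [dRadial, radialCoeff, sub_apply, smul_apply, innerSL_apply_apply, smul_eq_mul, nsmul_eq_mul, Nat.cast_ofNat]
  field_simp

/-- `Dh(x) x = −2h(x)` (the radial coefficient is homogeneous of degree `−2`). -/
theorem dRadial_apply_self (hx : x ∈ U) : dRadial Φ g x x = -2 * radialCoeff Φ x := by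
  have hn := hc.norm_ne_zero hx
  have he : ⟪g x, x⟫ = 0 := by rw [real_inner_comm]; exact hc.euler x hx
  simp only [dRadial, sub_apply, smul_apply, innerSL_apply_apply, smul_eq_mul, he, mul_zero, zero_sub, real_inner_self_eq_norm_sq]
  field_simp

/-- Near a point of `U` the conical flow is `g + h·id`. -/
theorem conicalField_eventuallyEq (hx : x ∈ U) : conicalField Φ =ᶠ[𝓝 x] fun y => g y + radialCoeff Φ y • y := by
  filter_upwards [hc.isOpen.mem_nhds hx] with y hy
  rw [conicalField, hc.gradient_eq hy]

/-- The conical flow at a point of `U`: `u = g + h x`. -/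
theorem conicalField_eq (hx : x ∈ U) : conicalField Φ x = g x + radialCoeff Φ x • x := by
  rw [conicalField, hc.gradient_eq hx]

/-- **The Jacobian of the conical flow**: `Du(x) = dField = H + h·Id + x ⊗ Dh`. -/
theorem hasFDerivAt_conicalField (hx : x ∈ U) : HasFDerivAt (conicalField Φ) (dField Φ g H x) x := by
  have h := (hc.hasFDerivAt_gradient x hx).add ((hc.hasFDerivAt_radialCoeff hx).smul (hasFDerivAt_id x))
  refine (h.congr_fderiv ?_).congr_of_eventuallyEq (hc.conicalField_eventuallyEq hx)
  simp only [dField, id]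
  abel

/-- `fderiv` form of the Jacobian. -/
theorem fderiv_conicalField (hx : x ∈ U) : fderiv ℝ (conicalField Φ) x = dField Φ g H x :=
  (hc.hasFDerivAt_conicalField hx).fderiv

/-- The conical flow is differentiable on `U`. -/
theorem differentiableAt_conicalField (hx : x ∈ U) : DifferentiableAt ℝ (conicalField Φ) x :=
  (hc.hasFDerivAt_conicalField hx).differentiableAt

/-! ### Divergence, curl, unthreadedness, homogeneity -/

/-- **`div u = 0`** on `U` (`div u = tr H + 3h + Dh(x) x = −h + 3h − 2h`). -/
theorem divergence_conicalField (hx : x ∈ U) : VectorCalculus.divergence (conicalField Φ) x = 0 := by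
  rw [VectorCalculus.divergence, hc.fderiv_conicalField hx, trace_eq_sum_coord]
  simp only [dField_apply]
  rw [Finset.sum_add_distrib, Finset.sum_add_distrib, hc.trace_hessian hx, sum_apply_single_mul, hc.dRadial_apply_self hx]
  simp only [PiLp.single_apply, Fin.sum_univ_three]
  simp
  ring

/-- `curlCLM` of a symmetric matrix vanishes: here for the Hessian. -/
theorem curlCLM_hessian (hx : x ∈ U) : curlCLM (H x) = 0 := by
  rw [curlCLM_apply]
  rw [hc.hessian_entry_symm hx 2 1, hc.hessian_entry_symm hx 0 2, hc.hessian_entry_symm hx 1 0]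
  ext i
  fin_cases i <;> simp

/-- **`curl u = (2e^{Φ}/|x|²) (∇Φ × x)`** on `U`. -/
theorem curl_conicalField (hx : x ∈ U) :
    curl (conicalField Φ) x = (2 * Real.exp (Φ x) / ‖x‖ ^ 2) • cross (g x) x := by
  rw [curl_eq_curlCLM, hc.fderiv_conicalField hx, dField, map_add, map_add, map_smul, hc.curlCLM_hessian hx, zero_add,
    dRadial_eq_innerSL, curlCLM_smulRight_innerSL]
  rw [curlCLM_id, smul_zero, zero_add, cross_sub_smul_self]

/-- **The conical flow is unthreaded about the vertex**: `⟪x − 0, curl u(x)⟫ = 0`. -/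
theorem inner_curl_conicalField (hx : x ∈ U) : ⟪x - 0, curl (conicalField Φ) x⟫ = 0 := by
  rw [sub_zero, hc.curl_conicalField hx, inner_smul_right, inner_cross_self_right, mul_zero]

/-- **The conical flow is homogeneous of degree `−1` about the vertex**: `Du(x)(x − 0) = −u(x)`. -/
theorem fderiv_conicalField_apply_self (hx : x ∈ U) : fderiv ℝ (conicalField Φ) x (x - 0) = -conicalField Φ x := by
  rw [sub_zero, hc.fderiv_conicalField hx, hc.conicalField_eq hx, dField]
  simp only [add_apply, smul_apply, ContinuousLinearMap.id_apply, ContinuousLinearMap.smulRight_apply, hc.hessian_apply_self hx,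
    hc.dRadial_apply_self hx]
  ext i
  simp only [PiLp.add_apply, PiLp.smul_apply, PiLp.neg_apply, smul_eq_mul]
  ring

end LiouvilleCone

end Summit.NavierStokesRegularity.NavierStokesRegularity.Theorems.PoloidalLiouville.AzimuthalCartan

end
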